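import Summits.BirchSwinnertonDyer.BirchSwinnertonDyer.Theorems.GenusKolyvaginAtTwoShaCardDvdPowAtTwoRTRelaxedIndexSha
import Summits.BirchSwinnertonDyer.BirchSwinnertonDyer.Theorems.GenusKolyvaginAtTwoPowDvdShaCardAtTwoRTHeegnerTwinTamagawaValuation
import Summits.BirchSwinnertonDyer.BirchSwinnertonDyer.Theorems.GenusKolyvaginAtTwoGenusPrimitiveSupplyAtTwoLocalTwoTorsion
import Summits.BirchSwinnertonDyer.BirchSwinnertonDyer.Theorems.GenusKolyvaginAtTwoGenusPrimitiveSupplyAtTwoTwistSelmerTransferDownRat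
import Summits.BirchSwinnertonDyer.BirchSwinnertonDyer.Theorems.GenusKolyvaginAtTwoGenusPrimitiveSupplyAtTwoHeegnerTwinTamagawaOdd
import Summits.BirchSwinnertonDyer.BirchSwinnertonDyer.Theorems.GenusKolyvaginAtTwoMazurRubinCor34iiDictionary
import Literature.NumberTheory.EllipticCurves.Greenberg1999.TwoTorsionQuadraticTwistPairTypeProofs
import HarnessLib

/-!
# Route `GenusKolyvaginAtTwo`, crux U_T `ShaCardDvdPowAtTwoRT` (stmt-BirchSwinnertonDyer-23658), LINE 19 `rational_pair_descent`,
# stub SANDWICH′ input (A) via (R′): the `Ш`-level relaxed index FOR THE TWIN `Wd ≅ E^(d_K)`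

Seat `bsd-line-gk2-p3` g26 (PROVER seat 3/3, cell `bsd-f1-sign2`), `--supports stmt-BirchSwinnertonDyer-23658` (helper; closes
nothing).  THEOREMS ONLY (no definition, no named fact, no `sorry`); standard axioms; unconditional.  BSD is NOT proved by any of
this; neither is U_T nor any stub.

WHY (LEAD gk2-p1 g19 22:59:44Z, gk2-p4 g22 23:02:13Z).  The LEAD's road for (A) `#(1−τ)X ≤ 2^{DEF}` runs through the twist
isomorphism `H¹(K, E_K) ≅ H¹(K, Wd_K)` (`τ ↦ −τ′`), `(1−τ)X ≅ (1+τ′)X′ = res′cor′X′ ⊂ res′(R′)` and the bound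
`#R′ ≤ #Ш(Wd/ℚ)[2^∞] · ∏_{q ∣ d_K} #H¹(ℚ_q, Wd)[2]` with `R′ = res′⁻¹(Ш(Wd/K)[2^∞]) ⊂ H¹(ℚ, Wd)` — i.e. this seat's (R)
(`…RTRelaxedIndexSha`, p749367) FOR THE TWIN.  The core of (R) is generic in the curve except for its hypothesis «`c` is a square
in `ℚ_v` at EVERY bad place», which fails for `Wd` at the primes of `d_K` (additive there); the proof uses it only OFF `c`.  So:

* §1 the primed variants with the bad-place hypothesis weakened to the places off `c`:
  `mem_localRestrictionKer_of_resBaseChange_mem_sha'`, **`natCard_comap_resBaseChange_shaPrimary_dvd'`**, `…_dvd_tors'`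
  (same statements and proofs as p749367's unprimed ones, `hbad` replaced by `hbad' : ∀ v, c ∉ v → ¬good v → c ∈ (ℚ_v^×)²`).
* §2 **`natCard_comap_resBaseChange_shaPrimary_twin_dvd_two_pow_onFrame`** — **(R′) on U_T's frame**: `W/ℚ` globally minimal with
  `Δ < 0` and `C(W)` odd, `K` imaginary quadratic with odd `d_K`, Heegner for `N_W`, `σ₀ ≠ 1`; for ANY elliptic model
  `Wd = Cd • W^{(d_K)}`: `#res′⁻¹(Ш(Wd/K)[2^∞]) ∣ #Ш(Wd/ℚ)[2^∞] · 2^{ord₂ C(Wd)}` (`Δ(Wd) < 0`; `Wd` is good off `d_K·N_W`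
  (`GenusKolyTwin.hasGoodReductionAtPrime_twist_of_not_dvd`) so its bad places off `d_K` split; `#Wd(ℚ_q)[2] = #W(ℚ_q)[2] = #roots_q + 1`
  (`GenusKolyTwistTamagawa.natCard_twoTorsion_padic_twist_eq`); `∏ (#roots_q + 1) = 2^{ord₂ C(Wd)}` (g17)).  With gk2-p5 g29's
  `natCard_primaryComponent_sha_twin_two_eq_one_onHabitat` (`Ш(Wd/ℚ)[2^∞] = 0` under the minimal twin): `#R′ ∣ 2^{ord₂ C(Wd)} ≤ 2`.

References: [Kramer1981] §2 Prop. 3, §4 (13); [MilneADT2006] I §3, §6; [McCallumLMS1991] §4 Lemma 4.3; [SilvermanAEC2009] VII.5, X.5 Cor. 5.4.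
-/

set_option autoImplicit false
set_option linter.dupNamespace false -- `Summit.<P>.<Sub>` repeats `BirchSwinnertonDyer` (D-0017)

noncomputable section

open scoped Classical

namespace Summit.BirchSwinnertonDyer.BirchSwinnertonDyer.Theorems.GenusExact.SelmerDescent

open WeierstrassCurve NumberField IsDedekindDomain Field
open Literature.NumberTheory.EllipticCurves Literature.NumberTheory.GaloisRepresentations
open Summit.BirchSwinnertonDyer.BirchSwinnertonDyer.Theorems.GenusExact.ArchVanishing
open Rat.HeightOneSpectrum (primesEquiv natGenerator)
open Literature.NumberTheory.DiophantineGeometry.UniformABCConjecture (natCast_mem_asIdeal_iff)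

/-! ## §1 (R) with the bad-place hypothesis only off `c` -/

section Primed

variable {K : Type} [Field K] [NumberField K] (W : WeierstrassCurve ℚ) [W.IsElliptic]

/-- **`res b ∈ Ш(E/K)` ⟹ `b` dies in `H¹(ℚ_v, E)` at every finite `v ∤ c`**, asking «`c` square in `ℚ_v`» only at the BAD places OFF `c`
(p749367's `mem_localRestrictionKer_of_resBaseChange_mem_sha` with `hbad` weakened; same proof).  [cite: McCallumLMS1991, §4 Lemma 4.3]
[cite: MilneADT2006, I Prop. 3.8 and I §6] -/
theorem mem_localRestrictionKer_of_resBaseChange_mem_sha' (h2 : Module.finrank ℚ K = 2) {θ : K}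
    (hθ : θ ∉ (algebraMap ℚ K).range) {c d : ℤ} (hcd : c = 1 + 4 * d) (hc : θ ^ 2 = algebraMap ℚ K c)
    (hbad' : ∀ v : HeightOneSpectrum (𝓞 ℚ), ((c : ℤ) : 𝓞 ℚ) ∉ v.asIdeal → ¬ W.HasGoodReductionAt v →
      ∃ s : v.adicCompletion ℚ, s ^ 2 = algebraMap ℚ (v.adicCompletion ℚ) c)
    {b : W.galH1} (hb : resBaseChange W K b ∈ (W.baseChange K).sha) (v : HeightOneSpectrum (𝓞 ℚ))
    (hcv : ((c : ℤ) : 𝓞 ℚ) ∉ v.asIdeal) : b ∈ W.localRestrictionKer (v.adicCompletion ℚ) := by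
  obtain ⟨w, hw⟩ := exists_liesOver K v
  have hbw : b ∈ W.localRestrictionKer (w.adicCompletion K) :=
    (mem_localRestrictionKer_iff_resBaseChange_mem W _).mpr ((((W.baseChange K).mem_sha_iff _).mp hb).1 w)
  by_cases hgood : W.HasGoodReductionAt v
  · have hcd' : ((c : ℤ) : 𝓞 ℚ) = 1 + 4 * ((d : ℤ) : 𝓞 ℚ) := by rw [hcd]; push_cast; ring
    have hc' : θ ^ 2 = algebraMap (𝓞 ℚ) K ((c : ℤ) : 𝓞 ℚ) := by
      rw [hc, IsScalarTower.algebraMap_apply (𝓞 ℚ) ℚ K, map_intCast, map_intCast, map_intCast]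
    exact mem_localRestrictionKer_of_tower_of_sq_eq_one_add_four_mul W K v w
      (adjoin_simple_eq_top_of_finrank_eq_two h2 hθ) hcd' hc' hgood hcv hbw
  · exact mem_localRestrictionKer_of_tower_of_finrank_eq_one W K v w
      (finrank_adicCompletion_eq_one_of_sq h2 hθ hc v w (hbad' v hcv hgood)) hbw

/-- **(R) with the weakened bad-place hypothesis: `#res⁻¹(Ш(E/K)[2^∞]) ∣ #Ш(E/ℚ)[2^∞] · ∏_{q ∈ D} #H¹(ℚ_q, E)[2]`** — p749367's
`natCard_comap_resBaseChange_shaPrimary_dvd` with `hbad` asked only off `c` (so it applies to the twin, which is additive at the primes of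
`c = d_K`); same proof.  [cite: Kramer1981, §2 Prop. 3 and §4 (13)] [cite: MilneADT2006, I §6] [cite: SerreGaloisCohomology1997, I §2.4] -/
theorem natCard_comap_resBaseChange_shaPrimary_dvd' (h2 : Module.finrank ℚ K = 2) {σ₀ : K ≃ₐ[ℚ] K} (hσ₀ : σ₀ ≠ 1)
    {θ : K} (hθ : θ ∉ (algebraMap ℚ K).range) {c d : ℤ} (hcd : c = 1 + 4 * d) (hc : θ ^ 2 = algebraMap ℚ K c)
    (hΔ : W.Δ < 0)
    (hbad' : ∀ v : HeightOneSpectrum (𝓞 ℚ), ((c : ℤ) : 𝓞 ℚ) ∉ v.asIdeal → ¬ W.HasGoodReductionAt v →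
      ∃ s : v.adicCompletion ℚ, s ^ 2 = algebraMap ℚ (v.adicCompletion ℚ) c)
    (D : Finset (HeightOneSpectrum (𝓞 ℚ))) (hD : ∀ q : HeightOneSpectrum (𝓞 ℚ), ((c : ℤ) : 𝓞 ℚ) ∈ q.asIdeal → q ∈ D) :
    Nat.card (((AddCommGroup.primaryComponent (W.baseChange K).sha 2).map (W.baseChange K).sha.subtype).comap
        (resBaseChange W K)) ∣
      Nat.card (AddCommGroup.primaryComponent W.sha 2) *
        ∏ q ∈ D, Nat.card (AddSubgroup.torsionBy (W.localH1 (q.adicCompletion ℚ)) (2 : ℤ)) := by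
  set R := ((AddCommGroup.primaryComponent (W.baseChange K).sha 2).map (W.baseChange K).sha.subtype).comap
    (resBaseChange W K) with hR
  have hmemR : ∀ b : R, resBaseChange W K (b : W.galH1) ∈ (W.baseChange K).sha ∧
      ∃ k : ℕ, 2 ^ k • resBaseChange W K (b : W.galH1) = 0 :=
    fun b ↦ (mem_comap_resBaseChange_shaPrimary_iff W (b : W.galH1)).mp b.2
  have h2loc : ∀ (b : R) (q : D), (2 : ℤ) • W.localRestrictionHom ((q : HeightOneSpectrum (𝓞 ℚ)).adicCompletion ℚ)
      (b : W.galH1) = 0 := by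
    intro b q
    have h := two_nsmul_mem_localRestrictionKer_of_resBaseChange_mem_sha W h2 (hmemR b).1 q
    rw [mem_localRestrictionKer_iff, map_nsmul] at h
    rwa [two_zsmul, ← two_nsmul]
  let Φ : R →+ ((q : D) → AddSubgroup.torsionBy (W.localH1 ((q : HeightOneSpectrum (𝓞 ℚ)).adicCompletion ℚ)) (2 : ℤ)) :=
    { toFun := fun b q => ⟨_, h2loc b q⟩
      map_zero' := by
        funext q
        ext
        simp
      map_add' := fun x y => by
        funext q
        ext
        simp }
  have hker_le : Φ.ker.map R.subtype ≤ (AddCommGroup.primaryComponent W.sha 2).map W.sha.subtype := by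
    rintro _ ⟨b, hb0, rfl⟩
    have hb0' : ∀ q : D, W.localRestrictionHom ((q : HeightOneSpectrum (𝓞 ℚ)).adicCompletion ℚ) (b : W.galH1) = 0 := by
      intro q
      have := congrArg (fun f => ((f q : AddSubgroup.torsionBy _ (2 : ℤ)) :
        W.localH1 ((q : HeightOneSpectrum (𝓞 ℚ)).adicCompletion ℚ))) (AddMonoidHom.mem_ker.mp hb0)
      simpa [Φ] using this
    have hbsha : (b : W.galH1) ∈ W.sha := by
      rw [mem_sha_iff]
      refine ⟨fun v ↦ ?_, fun w ↦ ?_⟩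
      · by_cases hcv : ((c : ℤ) : 𝓞 ℚ) ∈ v.asIdeal
        · rw [mem_localRestrictionKer_iff]
          exact hb0' ⟨v, hD v hcv⟩
        · exact mem_localRestrictionKer_of_resBaseChange_mem_sha' W h2 hθ hcd hc hbad' (hmemR b).1 v hcv
      · rw [localRestrictionKer_infinitePlace_eq_top_of_Δ_neg W w hΔ]
        trivial
    obtain ⟨-, k, hk⟩ := hmemR b
    have h2k : 2 ^ (k + 1) • (b : W.galH1) = 0 := by
      have hres0 : resBaseChange W K (2 ^ k • (b : W.galH1)) = 0 := by rw [map_nsmul, hk]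
      have h := two_nsmul_eq_zero_of_resBaseChange_eq_zero W h2 hσ₀ hres0
      rwa [smul_smul, ← pow_succ'] at h
    refine ⟨⟨(b : W.galH1), hbsha⟩, ?_, rfl⟩
    apply (AddCommGroup.mem_primaryComponent).mpr
    exact ⟨k + 1, Subtype.ext (by rw [AddSubgroupClass.coe_nsmul, ZeroMemClass.coe_zero]; exact h2k)⟩
  have hker : Nat.card Φ.ker ∣ Nat.card (AddCommGroup.primaryComponent W.sha 2) := by
    rw [Nat.card_congr (AddSubgroup.equivMapOfInjective Φ.ker R.subtype Subtype.coe_injective).toEquiv,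
      Nat.card_congr (AddSubgroup.equivMapOfInjective (AddCommGroup.primaryComponent W.sha 2) W.sha.subtype
        Subtype.coe_injective).toEquiv]
    exact AddSubgroup.card_dvd_of_le hker_le
  have hrange : Nat.card Φ.range ∣
      ∏ q ∈ D, Nat.card (AddSubgroup.torsionBy (W.localH1 (q.adicCompletion ℚ)) (2 : ℤ)) := by
    refine (AddSubgroup.card_addSubgroup_dvd_card Φ.range).trans ?_
    rw [Nat.card_pi, ← Finset.prod_coe_sort D]
  rw [AddSubgroup.card_eq_card_quotient_mul_card_addSubgroup Φ.ker,
    Nat.card_congr (QuotientAddGroup.quotientKerEquivRange Φ).toEquiv, mul_comm]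
  exact mul_dvd_mul hker hrange

/-- **(R) with the weakened bad-place hypothesis, points form**: `… ∣ #Ш(E/ℚ)[2^∞] · ∏_{q ∈ D} #E(ℚ_q)[2]` for `D` of odd places
(local Tate duality).  [cite: Kramer1981, §2 Prop. 3 and §4 (13)] [cite: MilneADT2006, I Thm. 3.2 and Lemma 3.3] -/
theorem natCard_comap_resBaseChange_shaPrimary_dvd_tors' (h2 : Module.finrank ℚ K = 2) {σ₀ : K ≃ₐ[ℚ] K} (hσ₀ : σ₀ ≠ 1)
    {θ : K} (hθ : θ ∉ (algebraMap ℚ K).range) {c d : ℤ} (hcd : c = 1 + 4 * d) (hc : θ ^ 2 = algebraMap ℚ K c)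
    (hΔ : W.Δ < 0)
    (hbad' : ∀ v : HeightOneSpectrum (𝓞 ℚ), ((c : ℤ) : 𝓞 ℚ) ∉ v.asIdeal → ¬ W.HasGoodReductionAt v →
      ∃ s : v.adicCompletion ℚ, s ^ 2 = algebraMap ℚ (v.adicCompletion ℚ) c)
    (D : Finset (HeightOneSpectrum (𝓞 ℚ))) (hD : ∀ q : HeightOneSpectrum (𝓞 ℚ), ((c : ℤ) : 𝓞 ℚ) ∈ q.asIdeal → q ∈ D)
    (hD2 : ∀ q ∈ D, (2 : 𝓞 ℚ) ∉ q.asIdeal) :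
    Nat.card (((AddCommGroup.primaryComponent (W.baseChange K).sha 2).map (W.baseChange K).sha.subtype).comap
        (resBaseChange W K)) ∣
      Nat.card (AddCommGroup.primaryComponent W.sha 2) *
        ∏ q ∈ D, Nat.card (nsmulAddMonoidHom (2 ^ 1) :
          (W.baseChange (q.adicCompletion ℚ)).toAffine.Point →+ _).ker := by
  have h := natCard_comap_resBaseChange_shaPrimary_dvd' W h2 hσ₀ hθ hcd hc hΔ hbad' D hD
  refine h.trans (dvd_of_eq ?_)
  congr 1
  refine Finset.prod_congr rfl fun q hq ↦ ?_
  have hloc := LocalDualityOrder.natCard_torsionBy_localH1_eq_of_not_mem q W (p := 2) (k := 1) one_ne_zero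
    (by exact_mod_cast hD2 q hq)
  change Nat.card (AddSubgroup.torsionBy (W.localH1 (q.adicCompletion ℚ)) ((2 ^ 1 : ℕ) : ℤ)) = _ at hloc
  rw [← hloc]
  norm_num

end Primed

/-! ## §2 (R′): the relaxed index for the twin on U_T's frame -/

section Twin

variable {K : Type} [Field K] [NumberField K] (W : WeierstrassCurve ℚ) [W.IsElliptic] [W.IsGloballyMinimal]

/-- **`#Wd(ℚ_v)[2] = #roots_p + 1` for a model `Wd = Cd • W^{(d)}` of a twist (`d ≠ 0`) at a place `v` over an odd prime `p ∤ Δ_min(W)`**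
(`#Wd(ℚ_p)[2] = #W(ℚ_p)[2]`, `GenusKolyTwistTamagawa.natCard_twoTorsion_padic_twist_eq`; then gk2-p5's `GenusKolyTwin.natCard_twoTorsion_padic_eq`).
[cite: MazurRubin2010, Remark 2.4 and Lemma 2.2 (i)] [cite: SilvermanAEC2009, VII.3 Prop. 3.1(b)] -/
theorem natCard_ker_two_adicCompletion_twist_eq_ncard_roots_add_one {d : ℚ} (hd : d ≠ 0) {Wd : WeierstrassCurve ℚ} [Wd.IsElliptic]
    {Cd : VariableChange ℚ} (hWd : Cd • W.quadraticTwist d = Wd) (v : HeightOneSpectrum (𝓞 ℚ))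
    (hp2 : ((primesEquiv v : Nat.Primes) : ℕ) ≠ 2) (hpΔ : ¬ (((primesEquiv v : Nat.Primes) : ℕ) : ℤ) ∣ minimalDiscriminantInt W) :
    Nat.card (nsmulAddMonoidHom (2 ^ 1) : (Wd.baseChange (v.adicCompletion ℚ)).toAffine.Point →+ _).ker =
      {x : ZMod ((primesEquiv v : Nat.Primes) : ℕ) | 4 * x ^ 3 + ((integralModelInt W).b₂ : ZMod ((primesEquiv v : Nat.Primes) : ℕ)) * x ^ 2 +
        2 * ((integralModelInt W).b₄ : ZMod ((primesEquiv v : Nat.Primes) : ℕ)) * x +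
          ((integralModelInt W).b₆ : ZMod ((primesEquiv v : Nat.Primes) : ℕ)) = 0}.ncard + 1 := by
  haveI := Fact.mk (primesEquiv v).2
  rw [GenusKolyTwistLocal.natCard_ker_nsmul_adicCompletion_eq_padic Wd v (2 ^ 1), pow_one,
    GenusKolyTwistTamagawa.natCard_twoTorsion_padic_twist_eq W hd hWd]
  exact GenusKolyTwin.natCard_twoTorsion_padic_eq W hp2 hpΔ

/-- **(R′) ON U_T's FRAME: `#res′⁻¹(Ш(Wd/K)[2^∞]) ∣ #Ш(Wd/ℚ)[2^∞] · 2^{ord₂ C(Wd)}` for ANY elliptic model `Wd = Cd • W^{(d_K)}` of the twin.**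
`W/ℚ` globally minimal elliptic with `Δ_W < 0` and `C(W)` odd; `K` imaginary quadratic with odd `d_K`, Heegner for `N_W`; `σ₀ ≠ 1` in `Aut(K/ℚ)`.
(§1 for the curve `Wd`: `Δ(Wd) < 0`; a bad place of `Wd` off `d_K` is bad for `W` (`GenusKolyTwin.hasGoodReductionAtPrime_twist_of_not_dvd`),
hence over `N_W`, hence split; `D` = the places of `d_K`, `#Wd(ℚ_q)[2] = #roots_q + 1`, `∏ (#roots_q + 1) = 2^{ord₂ C(Wd)}`.)
Input of the LEAD's (A) road (`(1−τ)X ≅ (1+τ′)X′ ⊂ res′(R′)`); with `Ш(Wd/ℚ)[2^∞] = 0` under the minimal twin: `#R′ ∣ 2^{ord₂ C(Wd)}`.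
[cite: Kramer1981, §2 Prop. 3 and Thm. 1] [cite: MilneADT2006, I §6] [cite: SilvermanAEC2009, X.5 Cor. 5.4] [cite: GrossLMS1991, §1 (p. 235)] -/
theorem natCard_comap_resBaseChange_shaPrimary_twin_dvd_two_pow_onFrame (hK : IsImaginaryQuadratic K) {σ₀ : K ≃ₐ[ℚ] K}
    (hσ₀ : σ₀ ≠ 1) (hodd : Odd (discr K)) (hH : SatisfiesHeegnerHypothesis (W.conductorNorm ℤ) K) (hΔ : W.Δ < 0)
    (hTam : Odd W.tamagawaProduct) {Wd : WeierstrassCurve ℚ} [Wd.IsElliptic] (Cd : VariableChange ℚ)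
    (hWd : Cd • W.quadraticTwist (discr K : ℚ) = Wd) :
    Nat.card (((AddCommGroup.primaryComponent (Wd.baseChange K).sha 2).map (Wd.baseChange K).sha.subtype).comap
        (resBaseChange Wd K)) ∣
      Nat.card (AddCommGroup.primaryComponent Wd.sha 2) * 2 ^ padicValNat 2 Wd.tamagawaProduct := by
  have h2 := hK.1
  obtain ⟨θ, hθ', hθ2⟩ := exists_sq_eq_discr_not_mem_range K h2
  have hθ : θ ∉ (algebraMap ℚ K).range := by
    rintro ⟨a, ha⟩
    exact hθ' ⟨a, ha⟩
  have hd4 : discr K % 4 = 1 := Literature.NumberTheory.QuadraticFields.Quadratic.discr_emod_four_eq_one hK.1 hodd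
  have hcd : discr K = 1 + 4 * (discr K / 4) := by omega
  have hd0 : discr K ≠ 0 := NumberField.discr_ne_zero K
  have hd0' : (discr K : ℚ) ≠ 0 := by exact_mod_cast hd0
  -- `Δ(Wd) < 0`
  have hΔd : Wd.Δ < 0 := by
    have hinv : Cd⁻¹ • Wd = W.quadraticTwist (discr K : ℚ) := by rw [← hWd, inv_smul_smul]
    exact (Literature.NumberTheory.EllipticCurves.Greenberg1999.Δ_neg_iff_of_smul_eq_quadraticTwist W Wd Cd⁻¹
      (discr K : ℚ) hinv hd0').mpr hΔ
  -- a bad place of `Wd` off `d_K` is over `N_W`, hence split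
  have hbad' : ∀ v : HeightOneSpectrum (𝓞 ℚ), ((discr K : ℤ) : 𝓞 ℚ) ∉ v.asIdeal → ¬ Wd.HasGoodReductionAt v →
      ∃ s : v.adicCompletion ℚ, s ^ 2 = algebraMap ℚ (v.adicCompletion ℚ) ((discr K : ℤ) : ℚ) := by
    intro v hdv hWdv
    haveI := Fact.mk (primesEquiv v).2
    have hpv : ((((primesEquiv v : Nat.Primes) : ℕ)) : 𝓞 ℚ) ∈ v.asIdeal := Rat.HeightOneSpectrum.natCast_natGenerator_mem v
    have hpd : ¬ ((((primesEquiv v : Nat.Primes) : ℕ)) : ℤ) ∣ discr K := by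
      rintro ⟨m, hm⟩
      apply hdv
      rw [hm]
      push_cast
      exact Ideal.mul_mem_right _ _ hpv
    by_cases hW : W.HasGoodReductionAt v
    · exfalso
      have hWp : W.HasGoodReductionAtPrime ((primesEquiv v : Nat.Primes) : ℕ) :=
        (hasGoodReductionAtPrime_iff_hasGoodReductionAt_ringOfIntegers v W).mpr hW
      have hWdp := GenusKolyTwin.hasGoodReductionAtPrime_twist_of_not_dvd W hd4 Cd hWd _ hWp hpd
      exact hWdv ((hasGoodReductionAtPrime_iff_hasGoodReductionAt_ringOfIntegers v Wd).mp hWdp)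
    · exact GenusKolyTwistLocal.exists_sq_eq_discr_adicCompletion_of_ncard_primesOver h2 v
        (hH _ (primesEquiv v).2 ((W.dvd_conductorNorm_iff v).mpr hW))
  -- `D` = the places over the primes of `d_K`
  set P : Finset ℕ := (discr K).natAbs.primeFactors with hP
  have hPmem : ∀ q : ℕ, q ∈ P ↔ q.Prime ∧ (q : ℤ) ∣ discr K := by
    intro q
    rw [hP, Nat.mem_primeFactors, Int.natCast_dvd]
    exact ⟨fun h ↦ ⟨h.1, h.2.1⟩, fun h ↦ ⟨h.1, h.2, Int.natAbs_ne_zero.mpr hd0⟩⟩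
  have hPodd : ∀ q : ℕ, q ∈ P → q ≠ 2 := by
    rintro q hq rfl
    exact (Int.not_even_iff_odd.mpr hodd) (even_iff_two_dvd.mpr (by exact_mod_cast ((hPmem 2).mp hq).2))
  let h : {q // q ∈ P} → HeightOneSpectrum (𝓞 ℚ) := fun q ↦
    (primesEquiv (R := 𝓞 ℚ)).symm ⟨q.1, ((hPmem q.1).mp q.2).1⟩
  have hh : ∀ q : {q // q ∈ P}, primesEquiv (h q) = ⟨q.1, ((hPmem q.1).mp q.2).1⟩ := fun q ↦
    Equiv.apply_symm_apply _ _
  have hinj : Function.Injective h := by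
    intro a b hab
    have := congrArg (fun v ↦ ((primesEquiv v : Nat.Primes) : ℕ)) hab
    simp only [hh] at this
    exact Subtype.ext this
  set D : Finset (HeightOneSpectrum (𝓞 ℚ)) := P.attach.image h with hD
  have hDmem : ∀ q : HeightOneSpectrum (𝓞 ℚ), ((discr K : ℤ) : 𝓞 ℚ) ∈ q.asIdeal → q ∈ D := by
    intro q hq
    have hnat : (((discr K).natAbs : ℕ) : 𝓞 ℚ) ∈ q.asIdeal := by
      rcases Int.natAbs_eq (discr K) with h' | h'
      · rw [h', Int.cast_natCast] at hq
        exact hq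
      · rw [h', Int.cast_neg, Int.cast_natCast] at hq
        exact neg_mem_iff.mp hq
    have hdvd : natGenerator q ∣ (discr K).natAbs := (natCast_mem_asIdeal_iff q _).mp hnat
    have hqP : natGenerator q ∈ P :=
      Nat.mem_primeFactors.mpr ⟨Rat.HeightOneSpectrum.prime_natGenerator q, hdvd, Int.natAbs_ne_zero.mpr hd0⟩
    refine Finset.mem_image.mpr ⟨⟨natGenerator q, hqP⟩, Finset.mem_attach _ _, ?_⟩
    change (primesEquiv (R := 𝓞 ℚ)).symm ⟨natGenerator q, _⟩ = q
    exact (Equiv.symm_apply_eq _).mpr rfl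
  have hD2 : ∀ q ∈ D, (2 : 𝓞 ℚ) ∉ q.asIdeal := by
    intro q hq
    obtain ⟨a, -, rfl⟩ := Finset.mem_image.mp hq
    have haP : a.1.Prime := ((hPmem a.1).mp a.2).1
    have hav : ((a.1 : ℕ) : 𝓞 ℚ) ∈ (h a).asIdeal := by
      have hmem := Rat.HeightOneSpectrum.natCast_natGenerator_mem (h a)
      have hgen : natGenerator (h a) = a.1 := congrArg (fun x : Nat.Primes ↦ (x : ℕ)) (hh a)
      rwa [hgen] at hmem
    have h2' := GenusKolyTwistingPrime.natCast_not_mem_of_not_dvd haP hav fun h2a ↦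
      hPodd a.1 a.2 ((Nat.prime_dvd_prime_iff_eq haP Nat.prime_two).mp h2a)
    exact_mod_cast h2'
  have hmain := natCard_comap_resBaseChange_shaPrimary_dvd_tors' Wd h2 hσ₀ hθ hcd hθ2 hΔd hbad' D hDmem hD2
  refine hmain.trans (dvd_of_eq ?_)
  congr 1
  rw [hD, Finset.prod_image fun a _ b _ hab ↦ hinj hab,
    ← PlusDescent.prod_ncard_roots_add_one_eq_two_pow_padicValNat_tamagawaProduct_twin W hK hodd hH hTam Cd hWd,
    ← Finset.prod_attach P]
  refine Finset.prod_congr rfl fun a _ ↦ ?_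
  obtain ⟨haP, hadvd⟩ := (hPmem a.1).mp a.2
  have ha2 : a.1 ≠ 2 := hPodd a.1 a.2
  have haΔ : ¬ (a.1 : ℤ) ∣ minimalDiscriminantInt W :=
    PlusDescent.not_dvd_minimalDiscriminantInt_of_dvd_discr_of_heegner W K h2 hH haP ha2 hadvd
  have hgen : ((primesEquiv (h a) : Nat.Primes) : ℕ) = a.1 := congrArg (fun x : Nat.Primes ↦ (x : ℕ)) (hh a)
  rw [natCard_ker_two_adicCompletion_twist_eq_ncard_roots_add_one W hd0' hWd (h a) (by rw [hgen]; exact ha2)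
    (by rw [hgen]; exact haΔ), hgen]

end Twin

end Summit.BirchSwinnertonDyer.BirchSwinnertonDyer.Theorems.GenusExact.SelmerDescent

end
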